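import Literature.MathematicalPhysics.QuantumFieldTheory.Balaban1983to89.B6Ineq258TowerD2
import Literature.MathematicalPhysics.QuantumFieldTheory.Balaban1983to89.B6Lemma21OneScaleTorus

/-!
# `Balaban1983to89.B6Ineq258OneScaleTorus` — T. Bałaban, *Propagators and renormalization transformations for lattice gauge
# theories. II*, Commun. Math. Phys. **96** (1984) 223–250 [Balaban1984PropagatorsII], the count (2.58) p.233: the VERBATIM
# typed display `B6Ineq258TowerD2.Ineq258Printed` HOLDS on the one-scale torus family (non-vacuity of the typing whose
# multi-scale instance is refuted in `B6Ineq258TowerD2`)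

statement-level skeleton of published theorems with citation tags; proofs where landed; nothing here is a claim about the Yang–Mills mass gap

PDF held: `paper:balaban1984-cmp96-propagators-rt-ii` (journal page = PDF page + 222); p. 233 [PDF 11] read as image.

CITATION HEADER (lean-in-tree rule).  WHAT IS REPRODUCED: lit-balaban SKELETON row **B6.Eq2.56** ((2.58) p. 233, the display
quoted verbatim in `…B6Ineq258TowerD2`).  STATE OF THE TREE: `…B6Ineq258TowerD2` (r03 g6, p256217) types (2.58) verbatim as
`Ineq258Printed d δ₀ α g`, proves the print's step (2.58) ∧ (2.59) ⇒ (2.61) and REFUTES (2.58) on the d = 2 two-level tower;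
`…B6Lemma21OneScaleTorus` (r03 g6, p254893) proves Lemma 2.1 verbatim on the ONE-SCALE torus family `oneScaleTorusGeo` of
`…B6Prop23OneScaleTorus` (Λ_k = T₁^{(k)} = Π_i ℤ/N_i, every site at scale k, d(y,y′) = |y − y′|_{T,1}).  THIS FILE: the same
display (2.58) HOLDS, as typed, on that one-scale family for every αδ₀ > 0 (`ineq258Printed_oneScaleTorus`): the row sum is
`≤ c₀(α)^{d+1} ≤ c₀(½α)^{d+1}` (`B6Lemma21OneScaleTorus.sum_exp_torusL1_le`, `c0_le_c0_half`), which is the `j′ = k, m = 0` term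
of the right-hand side of (2.58) (all other terms are ≥ 0; the summability guard of the typing makes the m-series honest
tsums).  So the typed predicate refuted in `…B6Ineq258TowerD2` is satisfiable on legitimate geometries of the paper's class —
the refutation is a property of MULTI-scale geometries (k ≥ 1 with a surface), exactly as for (2.61) (row B6.Lem2.1:
refuted on towers / true on one scale).  Unit `lit-balaban-r03` (B6 reader/owner, gen 6), PHASE 2, HOME
`run/shared/lean/pub/lit-balaban/`, 2026-08-21.  IMPORTS `…B6Ineq258TowerD2`, `…B6Lemma21OneScaleTorus` BY NAME; no new
definition, no new named fact (theorems only).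

## Honest scope

(i) One scale only (k arbitrary but a single level Λ_k, as in `…B6Lemma21OneScaleTorus`); says nothing about multi-scale
geometries beyond the tower refutation.  (ii) Value = kernel certificate of non-vacuity for a typed display of
[Balaban1984PropagatorsII]; NOT summit progress, NOT continuum, NOT Clay.
-/

namespace Literature.MathematicalPhysics.QuantumFieldTheory.Balaban1983to89.B6Ineq258OneScaleTorus

open Finset
open B6Ineq258TowerD2 (term258 series258 rhs258 Ineq258Printed floor_iff)
open B5QGGQ145Bounds (Idx toZ)
open B6Prop23OneScaleTorus (torusL1 oneScaleTorusGeo)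
open B6Lemma21OneScaleTorus (sum_exp_torusL1_le c0_le_c0_half)
open B6Lemma21Arith (one_le_c0)

noncomputable section

variable {d : ℕ}

/-- the terms of (2.58) are nonnegative. [cite: Balaban1984PropagatorsII, (2.58) p.233] [folklore] -/
theorem series258_nonneg {D : ℕ} {δ₀ α R M : ℝ} (hα : 0 < α * δ₀) (j j' m : ℕ) :
    0 ≤ series258 D δ₀ α R M j j' m := by
  unfold series258 term258
  have hc : 0 ≤ B6.c0 δ₀ (α / 2) := le_trans zero_le_one (one_le_c0 (by nlinarith))
  split_ifs
  · positivity
  · exact le_rfl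

/-- the `m = 0` term of the diagonal (`j′ = j`) series of (2.58) is `c₀(½α)^D`. [cite: Balaban1984PropagatorsII, (2.58) p.233] [folklore] -/
theorem series258_diag_zero {D : ℕ} {δ₀ α R M : ℝ} (j : ℕ) :
    series258 D δ₀ α R M j j 0 = B6.c0 δ₀ (α / 2) ^ D := by
  unfold series258 term258
  rw [if_pos (by simp)]
  simp

/-- **(2.58) AS PRINTED HOLDS ON THE ONE-SCALE TORUS FAMILY** `Λ_k = T₁^{(k)} = Π_i ℤ/N_i` (every site at scale k,
d(y,y′) = |y − y′|_{T,1}; any L, k, N, M, R), for every αδ₀ > 0: `Σ_{y′} e^{−αδ₀d(y,y′)} ≤ c₀(α)^{d+1} ≤ c₀(½α)^{d+1}` = the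
`j′ = k, m = 0` term of the right-hand side of (2.58), all other terms ≥ 0. [cite: Balaban1984PropagatorsII, (2.58) p.233] -/
theorem ineq258Printed_oneScaleTorus (L k : ℕ) (N : Fin (d + 1) → ℕ+) (M R : ℕ) {δ₀ α : ℝ} (h : 0 < α * δ₀) :
    Ineq258Printed (d + 1) δ₀ α (oneScaleTorusGeo d L k N M R) := by
  intro y hsum
  -- the left side: the torus row sum ≤ c₀(α)^{d+1} ≤ c₀(½α)^{d+1}
  have h1 : ∑ y' : Idx (fun i => (N i : ℕ)), Real.exp (-(α * δ₀ * torusL1 (fun i => (N i : ℕ)) (toZ y - toZ y')))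
      ≤ B6.c0 δ₀ α ^ (d + 1) :=
    sum_exp_torusL1_le (fun i => (N i : ℕ)) (fun i => (N i).pos) h y
  have hc0 : 0 ≤ B6.c0 δ₀ α := le_trans zero_le_one (one_le_c0 h)
  have h2 : B6.c0 δ₀ α ^ (d + 1) ≤ B6.c0 δ₀ (α / 2) ^ (d + 1) := pow_le_pow_left₀ hc0 (c0_le_c0_half h) _
  -- the right side: ≥ its j′ = k summand ≥ the m = 0 term
  have hk : (oneScaleTorusGeo d L k N M R).scale y = k := rfl
  have hsk : Summable (series258 (d + 1) δ₀ α (oneScaleTorusGeo d L k N M R).R (oneScaleTorusGeo d L k N M R).M k k) := by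
    have := hsum k; rwa [hk] at this
  have h3 : B6.c0 δ₀ (α / 2) ^ (d + 1)
      ≤ ∑' m : ℕ, series258 (d + 1) δ₀ α (oneScaleTorusGeo d L k N M R).R (oneScaleTorusGeo d L k N M R).M k k m := by
    rw [← series258_diag_zero (D := d + 1) (δ₀ := δ₀) (α := α) (R := (oneScaleTorusGeo d L k N M R).R)
      (M := (oneScaleTorusGeo d L k N M R).M) k]
    exact hsk.le_tsum 0 fun m _ => series258_nonneg h k k m
  have h4 : ∑' m : ℕ, series258 (d + 1) δ₀ α (oneScaleTorusGeo d L k N M R).R (oneScaleTorusGeo d L k N M R).M k k m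
      ≤ rhs258 (d + 1) δ₀ α (oneScaleTorusGeo d L k N M R) k := by
    unfold rhs258
    refine Finset.single_le_sum (f := fun j' => ∑' m : ℕ, series258 (d + 1) δ₀ α (oneScaleTorusGeo d L k N M R).R
      (oneScaleTorusGeo d L k N M R).M k j' m) (fun j' _ => tsum_nonneg fun m => series258_nonneg h k j' m) ?_
    show k ∈ Finset.range ((oneScaleTorusGeo d L k N M R).k + 1)
    exact Finset.mem_range.mpr (Nat.lt_succ_self k)
  show ∑ y' : Idx (fun i => (N i : ℕ)), Real.exp (-(α * δ₀ * torusL1 (fun i => (N i : ℕ)) (toZ y - toZ y')))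
    ≤ rhs258 (d + 1) δ₀ α (oneScaleTorusGeo d L k N M R) k
  exact h1.trans (h2.trans (h3.trans h4))

/-- hence the typed (2.58) is decided BOTH ways on the paper's class of geometries: true on every one-scale torus (this file),
false on the d = 2 two-level tower (`B6Ineq258TowerD2.not_ineq258Printed_tower`). [cite: Balaban1984PropagatorsII, (2.58) p.233] -/
theorem ineq258Printed_oneScale_and_not_tower {δ₀ α : ℝ} (hα : 0 < α) (hδ : 0 < δ₀) (h : α * δ₀ = 1 / 128)
    (L k : ℕ) (N : Fin 2 → ℕ+) (M R : ℕ) (η : ℝ) :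
    Ineq258Printed 2 δ₀ α (oneScaleTorusGeo 1 L k N M R) ∧
      ¬ Ineq258Printed 2 δ₀ α (B6LevelTower.twGeo 2 1 1573888 1100 1024 η 1100) :=
  ⟨ineq258Printed_oneScaleTorus L k N M R (mul_pos hα hδ), B6Ineq258TowerD2.not_ineq258Printed_tower hα hδ h η⟩

end

end Literature.MathematicalPhysics.QuantumFieldTheory.Balaban1983to89.B6Ineq258OneScaleTorus
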